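import Literature.NumberTheory.Sieve.MaynardSieve
import Literature.NumberTheory.Sieve.MaynardSmallK
import Literature.NumberTheory.Sieve.MaynardTaoLargeKProofs
import Literature.NumberTheory.Sieve.ParityWave0MaynardTaoProofs
import HarnessLib

/-!
# From `C¹` to square-integrable test functions in Maynard's Prop. 4.2 (the `L²` reduction)

Topic `Literature/NumberTheory/Sieve`. J. Maynard, *Small gaps between primes*, Ann. of Math. 181
(2015), Prop. 4.2 is vendored in the tree twice: for arbitrary square-integrable admissible test
functions `F` on `R_k` (`Literature.NumberTheory.Sieve.frequently_card_primes_ge_of_maynardFunctional`, `MaynardTao.lean`,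
the generality of Polymath 8b §3) and for `F = G · 1_{R_k}` with `G ∈ C¹`
(`Literature.NumberTheory.Sieve.frequently_card_primes_ge_of_maynardFunctional_smooth`, `MaynardSieve.lean`, the class for
which Prop. 4.1 is printed and deduced there from the two Prop. 4.1 facts `maynard_S1_asymptotic`,
`maynard_S2_asymptotic`). This file PROVES that the `C¹` case implies the general case
(`frequently_card_primes_ge_of_maynardFunctional_of_smooth`), hence the general Prop. 4.2 from the two
Prop. 4.1 facts (`frequently_card_primes_ge_of_maynardFunctional_of_asymptotics`), and records the
consequence for Maynard's Theorem 1.1 (`Parity.frequently_nth_prime_add_le_maynard_tao`, parity.S13):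
it follows from Bombieri–Vinogradov (`Parity.bombieri_vinogradov`) and the two Prop. 4.1 facts
(`Parity.frequently_nth_prime_add_le_maynard_tao_of_sieve_asymptotics`; Prop. 4.3 (3) being
discharged in `MaynardTaoLargeKProofs.lean`).

## The argument (the standard remark that `M_k` is the same over Maynard's class and over `L²`)

Given an admissible `F` (measurable, supported in `R_k`, `∫ F² < ∞`, `I_k(F) > 0`) with
`(∑ₘ J_k^{(m)}(F)) / I_k(F) > c ≥ 0`, we find a polynomial `G` with `1_{R_k} G` admissible and the
same strict inequality (`MaynardL2.exists_polynomial_maynardFunctional_gt`):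

* `√I_k` and `√J_k^{(m)}` are `L²([0,1]^k)`-seminorms: `I_k(F) = ‖F‖²`
  (`MaynardL2.maynardI_eq_toReal_sq`) and `J_k^{(m)}(F) = ‖A_m F‖²_{L²([0,1]^{k−1})}` with the fibre
  average `A_m F(s) = ∫₀¹ F(s with u inserted at m) du` (`MaynardL2.fibreAvg`, the tree's
  `maynardJ_succ_eq`), and `‖A_m φ‖ ≤ ‖φ‖` (`MaynardL2.eLpNorm_fibreAvg_le`: fibrewise Cauchy–Schwarz
  in `ℝ≥0∞`, `MaynardL2.ofReal_sq_intervalIntegral_le`, and Tonelli through the measure-preserving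
  splitting `(u, s) ↦ insertNth m u s`);
* hence `‖A_m F‖ ≤ ‖A_m Q‖ + ‖F − Q‖` for `Q = 1_{R_k} G` (`MaynardL2.eLpNorm_fibreAvg_le_add`; the
  pointwise step `|A_m F| ≤ |A_m Q| + |A_m(F − Q)|` holds at every `s`, by linearity where the fibre of
  `F` is integrable and trivially where it is not), and `‖Q‖ ≤ ‖F‖ + ‖F − Q‖`, `‖F‖ ≤ ‖Q‖ + ‖F − Q‖`;
* polynomials are dense in `L²([0,1]^k)` (`MaynardL2.exists_mvPolynomial_eLpNorm_sub_le`: continuous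
  compactly supported functions are dense, Mathlib's `MemLp.exists_hasCompactSupport_eLpNorm_sub_le`,
  and the coordinate polynomials are uniformly dense in `C([0,1]^k)`, Stone–Weierstrass,
  `ContinuousMap.exists_mem_subalgebra_near_continuous_of_isCompact_of_separatesPoints`);
* so with `‖F − Q‖ ≤ δ` small: `J^{(m)}(Q) ≥ J^{(m)}(F) − 2δ√J^{(m)}(F)`, `I(Q) ≤ (√I(F) + δ)²`,
  `I(Q) > 0`, and the strict inequality survives.

## References

* J. Maynard, *Small gaps between primes*, Ann. of Math. (2) 181 (2015), 383–413, Prop. 4.1, 4.2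
  (the class of "piecewise differentiable" `F`), Theorem 1.1. [cite: MaynardAnnals2015]
* D. H. J. Polymath, *Variants of the Selberg sieve, and bounded intervals containing many primes*,
  Res. Math. Sci. 1:12 (2014), §3 (test functions in `L²`; the suprema agree). [cite: Polymath8b2014]
-/

noncomputable section

open MeasureTheory Set Filter
open scoped ENNReal

namespace Literature.NumberTheory.Sieve

namespace MaynardL2

variable {n : ℕ}

/-! ### Fibre averages along the `m`-th coordinate -/

/-- The fibre average `A_m φ (s) = ∫₀¹ φ(insertNth m u s) du` (the inner integral of `J_k^{(m)}`).
[cite: MaynardAnnals2015, Prop. 4.1 (definition of J_k^{(m)})] -/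
def fibreAvg (m : Fin (n + 1)) (φ : (Fin (n + 1) → ℝ) → ℝ) (s : Fin n → ℝ) : ℝ :=
  ∫ u in (0 : ℝ)..1, φ (Fin.insertNth m u s)

/-- Unfolding `fibreAvg`. [folklore] -/
theorem fibreAvg_def (m : Fin (n + 1)) (φ : (Fin (n + 1) → ℝ) → ℝ) (s : Fin n → ℝ) :
    fibreAvg m φ s = ∫ u in (0 : ℝ)..1, φ (Fin.insertNth m u s) := rfl

/-- The fibre average is strongly measurable in `s` (for measurable `φ`). [folklore] -/
theorem stronglyMeasurable_fibreAvg (m : Fin (n + 1)) {φ : (Fin (n + 1) → ℝ) → ℝ}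
    (hφ : Measurable φ) : StronglyMeasurable (fibreAvg m φ) :=
  MaynardLargeK.stronglyMeasurable_intervalIntegral_insertNth m hφ

/-- `J_k^{(m)}(φ) = ∫_{[0,1]^n} (A_m (1_{R_k} φ))²` (Fubini; the tree's `maynardJ_succ_eq`).
[cite: MaynardAnnals2015, Prop. 4.1 (definition of J_k^{(m)})] -/
theorem maynardJ_eq_integral_fibreAvg (m : Fin (n + 1)) (φ : (Fin (n + 1) → ℝ) → ℝ) :
    maynardJ (n + 1) m φ =
      ∫ s in maynardCube n, fibreAvg m ((maynardSimplex (n + 1)).indicator φ) s ^ 2 :=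
  MaynardTao.maynardJ_succ_eq m φ

/-- The one-dimensional Cauchy–Schwarz step, in `ℝ≥0∞` (no integrability needed):
`(∫₀¹ g)² ≤ ∫_{(0,1]} g²` for measurable `g`. [folklore] -/
theorem ofReal_sq_intervalIntegral_le {g : ℝ → ℝ} (hg : Measurable g) :
    ENNReal.ofReal ((∫ u in (0 : ℝ)..1, g u) ^ 2) ≤ ∫⁻ u in Ioc (0 : ℝ) 1, ENNReal.ofReal (g u ^ 2) := by
  rw [intervalIntegral.integral_of_le zero_le_one]
  -- pass to `‖·‖ₑ`
  have step1 : ENNReal.ofReal ((∫ u in Ioc (0 : ℝ) 1, g u) ^ 2) ≤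
      (∫⁻ u in Ioc (0 : ℝ) 1, ‖g u‖ₑ) ^ 2 := by
    rw [← sq_abs, ENNReal.ofReal_pow (abs_nonneg _), ← Real.enorm_eq_ofReal_abs]
    gcongr
    exact enorm_integral_le_lintegral_enorm _
  -- Hölder with exponents `2, 2` against the constant function `1`
  have step2 : ∫⁻ u in Ioc (0 : ℝ) 1, ‖g u‖ₑ ≤
      (∫⁻ u in Ioc (0 : ℝ) 1, ‖g u‖ₑ ^ (2 : ℝ)) ^ (1 / 2 : ℝ) *
        (∫⁻ u in Ioc (0 : ℝ) 1, (fun _ => (1 : ℝ≥0∞)) u ^ (2 : ℝ)) ^ (1 / 2 : ℝ) := by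
    have := ENNReal.lintegral_mul_le_Lp_mul_Lq (volume.restrict (Ioc (0 : ℝ) 1))
      Real.HolderConjugate.two_two hg.enorm.aemeasurable (f := fun u => ‖g u‖ₑ)
      (g := fun _ => (1 : ℝ≥0∞)) aemeasurable_const
    simpa using this
  have hconst : (∫⁻ u in Ioc (0 : ℝ) 1, (fun _ => (1 : ℝ≥0∞)) u ^ (2 : ℝ)) = 1 := by
    simp [Real.volume_Ioc]
  rw [hconst, ENNReal.one_rpow, mul_one] at step2
  calc ENNReal.ofReal ((∫ u in Ioc (0 : ℝ) 1, g u) ^ 2)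
      ≤ (∫⁻ u in Ioc (0 : ℝ) 1, ‖g u‖ₑ) ^ 2 := step1
    _ ≤ ((∫⁻ u in Ioc (0 : ℝ) 1, ‖g u‖ₑ ^ (2 : ℝ)) ^ (1 / 2 : ℝ)) ^ 2 := by gcongr
    _ = ∫⁻ u in Ioc (0 : ℝ) 1, ‖g u‖ₑ ^ (2 : ℝ) := by
        rw [← ENNReal.rpow_natCast, ← ENNReal.rpow_mul]; norm_num
    _ = ∫⁻ u in Ioc (0 : ℝ) 1, ENNReal.ofReal (g u ^ 2) := by
        refine lintegral_congr fun u => ?_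
        rw [ENNReal.rpow_two, Real.enorm_eq_ofReal_abs, ← ENNReal.ofReal_pow (abs_nonneg _), sq_abs]


/-- The splitting map `(u, s) ↦ insertNth m u s` identifies `[0,1] × [0,1]^n` with `[0,1]^{n+1}`
and preserves Lebesgue measure. [folklore] -/
theorem measurePreserving_insertNth (m : Fin (n + 1)) :
    MeasurePreserving (fun p : ℝ × (Fin n → ℝ) => (Fin.insertNth (α := fun _ => ℝ) m p.1 p.2 : Fin (n + 1) → ℝ))
      ((volume : Measure ℝ).prod volume) volume := by
  have h := (volume_preserving_piFinSuccAbove (fun _ : Fin (n + 1) => ℝ) m).symm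
  rw [Measure.volume_eq_prod] at h
  have hfun : (fun p : ℝ × (Fin n → ℝ) => (Fin.insertNth (α := fun _ => ℝ) m p.1 p.2 : Fin (n + 1) → ℝ)) =
      ⇑(MeasurableEquiv.piFinSuccAbove (fun _ : Fin (n + 1) => ℝ) m).symm := by
    funext p
    rw [MeasurableEquiv.piFinSuccAbove_symm_apply]
    rfl
  rw [hfun]
  exact h

/-- The preimage of the cube under the splitting map. [folklore] -/
theorem preimage_insertNth_maynardCube (m : Fin (n + 1)) :
    (fun p : ℝ × (Fin n → ℝ) => (Fin.insertNth (α := fun _ => ℝ) m p.1 p.2 : Fin (n + 1) → ℝ)) ⁻¹' maynardCube (n + 1) =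
      Icc (0 : ℝ) 1 ×ˢ maynardCube n := by
  ext ⟨x, s⟩
  simp only [Set.mem_preimage, Set.mem_prod]
  exact MaynardLargeK.insertNth_mem_maynardCube_iff m x s

/-- **Fibre Cauchy–Schwarz plus Tonelli** (in `ℝ≥0∞`): for measurable `φ`,
`∫_{[0,1]^n} (A_m φ)² ≤ ∫_{[0,1]^{n+1}} φ²`. [folklore] -/
theorem lintegral_fibreAvg_sq_le (m : Fin (n + 1)) {φ : (Fin (n + 1) → ℝ) → ℝ} (hφ : Measurable φ) :
    ∫⁻ s in maynardCube n, ENNReal.ofReal (fibreAvg m φ s ^ 2) ≤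
      ∫⁻ t in maynardCube (n + 1), ENNReal.ofReal (φ t ^ 2) := by
  set G : ℝ × (Fin n → ℝ) → ℝ≥0∞ := fun p => ENNReal.ofReal (φ (Fin.insertNth (α := fun _ => ℝ) m p.1 p.2) ^ 2) with hG
  have hins : Measurable fun p : ℝ × (Fin n → ℝ) => (Fin.insertNth (α := fun _ => ℝ) m p.1 p.2 : Fin (n + 1) → ℝ) :=
    (measurePreserving_insertNth m).measurable
  have hGm : Measurable G := ((hφ.comp hins).pow_const 2).ennreal_ofReal
  -- pointwise fibre bound
  have h1 : ∫⁻ s in maynardCube n, ENNReal.ofReal (fibreAvg m φ s ^ 2) ≤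
      ∫⁻ s in maynardCube n, ∫⁻ u in Ioc (0 : ℝ) 1, G (u, s) := by
    refine lintegral_mono fun s => ?_
    exact ofReal_sq_intervalIntegral_le (g := fun u => φ (Fin.insertNth m u s))
      (hφ.comp (continuous_id.finInsertNth m continuous_const).measurable)
  -- Tonelli
  have h2 : ∫⁻ s in maynardCube n, ∫⁻ u in Ioc (0 : ℝ) 1, G (u, s) =
      ∫⁻ p in Ioc (0 : ℝ) 1 ×ˢ maynardCube n, G p ∂((volume : Measure ℝ).prod volume) := by
    rw [← Measure.prod_restrict, lintegral_prod_symm _ hGm.aemeasurable]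
  -- enlarge `Ioc` to `Icc` and transport to the cube
  have h3 : ∫⁻ p in Ioc (0 : ℝ) 1 ×ˢ maynardCube n, G p ∂((volume : Measure ℝ).prod volume) ≤
      ∫⁻ p in Icc (0 : ℝ) 1 ×ˢ maynardCube n, G p ∂((volume : Measure ℝ).prod volume) :=
    lintegral_mono_set (Set.prod_mono Ioc_subset_Icc_self le_rfl)
  have h4 : ∫⁻ p in Icc (0 : ℝ) 1 ×ˢ maynardCube n, G p ∂((volume : Measure ℝ).prod volume) =
      ∫⁻ t in maynardCube (n + 1), ENNReal.ofReal (φ t ^ 2) := by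
    rw [← preimage_insertNth_maynardCube m]
    exact (measurePreserving_insertNth m).setLIntegral_comp_preimage
      (MaynardLargeK.measurableSet_maynardCube _) ((hφ.pow_const 2).ennreal_ofReal)
  calc _ ≤ _ := h1
    _ = _ := h2
    _ ≤ _ := h3
    _ = _ := h4


/-! ### `L²` norms as `eLpNorm … 2` -/

section L2

variable {α : Type*} [MeasurableSpace α] {μ : Measure α}

omit [MeasurableSpace α] in
/-- `‖f x‖ₑ² = ofReal (f x)²`. [folklore] -/
theorem enorm_rpow_two_eq (f : α → ℝ) (x : α) : ‖f x‖ₑ ^ (2 : ℝ) = ENNReal.ofReal (f x ^ 2) := by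
  rw [ENNReal.rpow_two, Real.enorm_eq_ofReal_abs, ← ENNReal.ofReal_pow (abs_nonneg _), sq_abs]

/-- `‖f‖_{L²(μ)} = (∫ f² dμ)^{1/2}` in `ℝ≥0∞`. [folklore] -/
theorem eLpNorm_two_eq (f : α → ℝ) :
    eLpNorm f 2 μ = (∫⁻ x, ENNReal.ofReal (f x ^ 2) ∂μ) ^ (1 / 2 : ℝ) := by
  rw [eLpNorm_eq_lintegral_rpow_enorm_toReal (by norm_num) (by norm_num)]
  have h2 : (2 : ℝ≥0∞).toReal = 2 := by norm_num
  have : ∀ x, ‖f x‖ₑ ^ (2 : ℝ≥0∞).toReal = ENNReal.ofReal (f x ^ 2) := fun x => by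
    rw [h2, enorm_rpow_two_eq]
  simp_rw [this, h2]

/-- `‖f‖²_{L²(μ)} = ∫ f² dμ` for square-integrable `f`. [folklore] -/
theorem eLpNorm_two_sq_eq_ofReal_integral {f : α → ℝ} (hf : Integrable (fun x => f x ^ 2) μ) :
    eLpNorm f 2 μ ^ 2 = ENNReal.ofReal (∫ x, f x ^ 2 ∂μ) := by
  rw [eLpNorm_two_eq, ← ENNReal.rpow_natCast, ← ENNReal.rpow_mul]
  norm_num
  rw [ofReal_integral_eq_lintegral_ofReal hf (ae_of_all _ fun x => sq_nonneg _)]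

/-- `∫ f² dμ = (‖f‖_{L²(μ)}²).toReal` for square-integrable `f`. [folklore] -/
theorem integral_sq_eq_toReal {f : α → ℝ} (hf : Integrable (fun x => f x ^ 2) μ) :
    ∫ x, f x ^ 2 ∂μ = (eLpNorm f 2 μ ^ 2).toReal := by
  rw [eLpNorm_two_sq_eq_ofReal_integral hf, ENNReal.toReal_ofReal (integral_nonneg fun x => sq_nonneg _)]

end L2

/-- **`‖A_m φ‖_{L²([0,1]^n)} ≤ ‖φ‖_{L²([0,1]^{n+1})}`** for measurable `φ` (the contraction property of
fibre averaging; Maynard uses it implicitly in `J_k^{(m)} ≤ I_k`). [folklore] -/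
theorem eLpNorm_fibreAvg_le (m : Fin (n + 1)) {φ : (Fin (n + 1) → ℝ) → ℝ} (hφ : Measurable φ) :
    eLpNorm (fibreAvg m φ) 2 (volume.restrict (maynardCube n)) ≤
      eLpNorm φ 2 (volume.restrict (maynardCube (n + 1))) := by
  rw [eLpNorm_two_eq, eLpNorm_two_eq]
  exact ENNReal.rpow_le_rpow (lintegral_fibreAvg_sq_le m hφ) (by norm_num)

/-- **Pointwise subadditivity of fibre averages** when the second function has integrable fibres:
`|A F(s)| ≤ |A Q(s)| + |A (F − Q)(s)|` for every `s` (if the fibre of `F` at `s` is integrable this is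
linearity of the integral; otherwise `A F(s) = 0`). [folklore] -/
theorem abs_fibreAvg_le (m : Fin (n + 1)) (F Q : (Fin (n + 1) → ℝ) → ℝ)
    (hQ : ∀ s, IntervalIntegrable (fun u => Q (Fin.insertNth m u s)) volume 0 1) (s : Fin n → ℝ) :
    |fibreAvg m F s| ≤ |fibreAvg m Q s| + |fibreAvg m (F - Q) s| := by
  by_cases hF : IntervalIntegrable (fun u => F (Fin.insertNth m u s)) volume 0 1
  · have : fibreAvg m F s = fibreAvg m Q s + fibreAvg m (F - Q) s := by
      simp only [fibreAvg, Pi.sub_apply]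
      rw [← intervalIntegral.integral_add (hQ s) (hF.sub (hQ s))]
      refine intervalIntegral.integral_congr fun u _ => ?_
      simp
    rw [this]
    exact abs_add_le _ _
  · rw [fibreAvg, intervalIntegral.integral_undef hF, abs_zero]
    positivity

/-- **The `J`-direction of the continuity estimate**: for measurable `F`, `Q` with `Q` having
integrable fibres,
`‖A_m F‖_{L²} ≤ ‖A_m Q‖_{L²} + ‖F − Q‖_{L²([0,1]^{n+1})}`. [folklore] -/
theorem eLpNorm_fibreAvg_le_add (m : Fin (n + 1)) {F Q : (Fin (n + 1) → ℝ) → ℝ}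
    (hF : Measurable F) (hQm : Measurable Q)
    (hQ : ∀ s, IntervalIntegrable (fun u => Q (Fin.insertNth m u s)) volume 0 1) :
    eLpNorm (fibreAvg m F) 2 (volume.restrict (maynardCube n)) ≤
      eLpNorm (fibreAvg m Q) 2 (volume.restrict (maynardCube n)) +
        eLpNorm (F - Q) 2 (volume.restrict (maynardCube (n + 1))) := by
  have hmeas : ∀ φ : (Fin (n + 1) → ℝ) → ℝ, Measurable φ →
      AEStronglyMeasurable (fibreAvg m φ) (volume.restrict (maynardCube n)) := fun φ hφ =>
    (stronglyMeasurable_fibreAvg m hφ).aestronglyMeasurable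
  calc eLpNorm (fibreAvg m F) 2 (volume.restrict (maynardCube n))
      ≤ eLpNorm (fun s => |fibreAvg m Q s| + |fibreAvg m (F - Q) s|) 2
          (volume.restrict (maynardCube n)) := by
        refine eLpNorm_mono_real fun s => ?_
        rw [Real.norm_eq_abs]
        exact abs_fibreAvg_le m F Q hQ s
    _ ≤ eLpNorm (fun s => |fibreAvg m Q s|) 2 (volume.restrict (maynardCube n)) +
          eLpNorm (fun s => |fibreAvg m (F - Q) s|) 2 (volume.restrict (maynardCube n)) := by
        refine eLpNorm_add_le ?_ ?_ (by norm_num)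
        · exact (hmeas Q hQm).norm
        · exact (hmeas (F - Q) (hF.sub hQm)).norm
    _ = eLpNorm (fibreAvg m Q) 2 (volume.restrict (maynardCube n)) +
          eLpNorm (fibreAvg m (F - Q)) 2 (volume.restrict (maynardCube n)) := by
        have h1 := eLpNorm_norm (fibreAvg m Q) (p := 2) (μ := volume.restrict (maynardCube n))
        have h2 := eLpNorm_norm (fibreAvg m (F - Q)) (p := 2) (μ := volume.restrict (maynardCube n))
        simp only [Real.norm_eq_abs] at h1 h2
        rw [h1, h2]
    _ ≤ _ := by
        gcongr
        exact eLpNorm_fibreAvg_le m (hF.sub hQm)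


/-! ### Density of polynomials in `L²` of the cube -/

/-- Evaluation of a multivariate polynomial is smooth. [folklore] -/
theorem contDiff_mvPolynomial_eval {k : ℕ} (q : MvPolynomial (Fin k) ℝ) :
    ContDiff ℝ ⊤ (fun x : Fin k → ℝ => MvPolynomial.eval x q) := by
  induction q using MvPolynomial.induction_on with
  | C a => simpa using contDiff_const
  | add p q hp hq => simpa using hp.add hq
  | mul_X p i hp => simpa using hp.mul (contDiff_apply ℝ ℝ i)

/-- The polynomial subalgebra of `C(ℝ^k, ℝ)` generated by the coordinate functions
`ContinuousMap.eval i` separates points. [folklore] -/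
theorem separatesPoints_adjoin_coord (k : ℕ) :
    (Algebra.adjoin ℝ (Set.range fun i : Fin k => (ContinuousMap.eval i : C(Fin k → ℝ, ℝ)))).SeparatesPoints := by
  intro x y hxy
  obtain ⟨i, hi⟩ := Function.ne_iff.1 hxy
  refine ⟨⇑(ContinuousMap.eval i : C(Fin k → ℝ, ℝ)),
    ⟨ContinuousMap.eval i, Algebra.subset_adjoin ⟨i, rfl⟩, rfl⟩, ?_⟩
  simpa using hi

/-- Elements of the coordinate subalgebra are polynomial functions. [folklore] -/
theorem exists_mvPolynomial_of_mem_adjoin {k : ℕ} {g : C(Fin k → ℝ, ℝ)}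
    (hg : g ∈ Algebra.adjoin ℝ (Set.range fun i : Fin k => (ContinuousMap.eval i : C(Fin k → ℝ, ℝ)))) :
    ∃ q : MvPolynomial (Fin k) ℝ, ∀ x, g x = MvPolynomial.eval x q := by
  rw [Algebra.adjoin_range_eq_range_aeval] at hg
  obtain ⟨q, rfl⟩ := hg
  refine ⟨q, fun x => ?_⟩
  change (MvPolynomial.aeval (fun i : Fin k => (ContinuousMap.eval i : C(Fin k → ℝ, ℝ))) q) x =
    MvPolynomial.eval x q
  -- evaluate the algebra-valued `aeval` at the point `x`
  set ev : C(Fin k → ℝ, ℝ) →ₐ[ℝ] ℝ :=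
    (Pi.evalAlgHom ℝ (fun _ : Fin k → ℝ => ℝ) x).comp (ContinuousMap.coeFnAlgHom ℝ) with hev
  have h1 : ev (MvPolynomial.aeval (fun i : Fin k => (ContinuousMap.eval i : C(Fin k → ℝ, ℝ))) q) =
      MvPolynomial.aeval (fun i => ev (ContinuousMap.eval i : C(Fin k → ℝ, ℝ))) q := by
    rw [← AlgHom.comp_apply, MvPolynomial.comp_aeval]
  have h2 : ∀ i, ev (ContinuousMap.eval i : C(Fin k → ℝ, ℝ)) = x i := fun i => rfl
  have h3 : ev (MvPolynomial.aeval (fun i : Fin k => (ContinuousMap.eval i : C(Fin k → ℝ, ℝ))) q) =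
      (MvPolynomial.aeval (fun i : Fin k => (ContinuousMap.eval i : C(Fin k → ℝ, ℝ))) q) x := rfl
  rw [← h3, h1]
  simp_rw [h2]
  rfl

/-- The unit cube is compact. [folklore] -/
theorem isCompact_maynardCube (k : ℕ) : IsCompact (maynardCube k) :=
  isCompact_univ_pi fun _ => isCompact_Icc

/-- The volume of the unit cube is `1`. [folklore] -/
theorem volume_maynardCube (k : ℕ) : volume (maynardCube k) = 1 := by
  rw [maynardCube, volume_pi_pi]
  simp [Real.volume_Icc]

/-- **Polynomials are dense in `L²` of the cube**: a measurable `F` supported in the cube with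
`∫_{cube} F² < ∞` is within any `ε > 0` in `L²([0,1]^k)` of a polynomial function
(continuous compactly supported functions are dense in `L²`, Mathlib's
`MemLp.exists_hasCompactSupport_eLpNorm_sub_le`, and polynomials are uniformly dense in the
continuous functions on the compact cube, Stone–Weierstrass). [folklore] -/
theorem exists_mvPolynomial_eLpNorm_sub_le {k : ℕ} {F : (Fin k → ℝ) → ℝ} (hFm : Measurable F)
    (hsupp : Function.support F ⊆ maynardCube k) (hF2 : IntegrableOn (fun t => F t ^ 2) (maynardCube k))
    {ε : ℝ≥0∞} (hε : ε ≠ 0) :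
    ∃ q : MvPolynomial (Fin k) ℝ,
      eLpNorm (fun x => F x - MvPolynomial.eval x q) 2 (volume.restrict (maynardCube k)) ≤ ε := by
  -- `F ∈ L²(volume)` globally
  have hind : (maynardCube k).indicator F = F := Set.indicator_eq_self.2 hsupp
  have hF2' : Integrable (fun t => F t ^ 2) volume := by
    have : (fun t => F t ^ 2) = (maynardCube k).indicator (fun t => F t ^ 2) := by
      funext t
      by_cases ht : t ∈ maynardCube k
      · rw [Set.indicator_of_mem ht]
      · rw [Set.indicator_of_notMem ht]
        have : F t = 0 := by rw [← hind, Set.indicator_of_notMem ht]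
        rw [this]; ring
    rw [this, integrable_indicator_iff (MaynardLargeK.measurableSet_maynardCube k)]
    exact hF2
  have hFmem : MemLp F 2 volume :=
    (memLp_two_iff_integrable_sq hFm.aestronglyMeasurable).2 hF2'
  -- half of `ε`
  have hε2 : ε / 2 ≠ 0 := by simpa using hε
  obtain ⟨g, -, hgF, hgc, -⟩ := hFmem.exists_hasCompactSupport_eLpNorm_sub_le (p := 2)
    ENNReal.ofNat_ne_top hε2
  -- Stone–Weierstrass on the compact cube
  rcases eq_or_ne ε ⊤ with hεt | hεt
  · exact ⟨0, by rw [hεt]; exact le_top⟩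
  have hε2r : 0 < (ε / 2).toReal := ENNReal.toReal_pos hε2 (by
    exact ENNReal.div_ne_top hεt two_ne_zero |> fun h => h)
  obtain ⟨p, hpA, hpg⟩ := ContinuousMap.exists_mem_subalgebra_near_continuous_of_isCompact_of_separatesPoints
    (separatesPoints_adjoin_coord k) ⟨g, hgc⟩ (isCompact_maynardCube k) hε2r
  obtain ⟨q, hq⟩ := exists_mvPolynomial_of_mem_adjoin hpA
  refine ⟨q, ?_⟩
  -- combine
  have hmeasP : AEStronglyMeasurable (fun x => MvPolynomial.eval x q) (volume.restrict (maynardCube k)) :=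
    (contDiff_mvPolynomial_eval q).continuous.aestronglyMeasurable
  calc eLpNorm (fun x => F x - MvPolynomial.eval x q) 2 (volume.restrict (maynardCube k))
      = eLpNorm ((F - g) + (fun x => g x - MvPolynomial.eval x q)) 2 (volume.restrict (maynardCube k)) := by
        congr 1; funext x; simp
    _ ≤ eLpNorm (F - g) 2 (volume.restrict (maynardCube k)) +
          eLpNorm (fun x => g x - MvPolynomial.eval x q) 2 (volume.restrict (maynardCube k)) :=
        eLpNorm_add_le ((hFm.aestronglyMeasurable.sub hgc.aestronglyMeasurable))
          (hgc.aestronglyMeasurable.sub hmeasP) (by norm_num)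
    _ ≤ ε / 2 + ε / 2 := by
        gcongr
        · exact (eLpNorm_mono_measure _ Measure.restrict_le_self).trans hgF
        · refine (eLpNorm_le_of_ae_bound (C := (ε / 2).toReal) ?_).trans ?_
          · rw [ae_restrict_iff' (MaynardLargeK.measurableSet_maynardCube k)]
            refine ae_of_all _ fun x hx => ?_
            have := hpg x hx
            rw [← hq x]
            rw [Real.norm_eq_abs, abs_sub_comm]
            exact (le_of_lt (by simpa [Real.norm_eq_abs] using this))
          · rw [Measure.restrict_apply_univ, volume_maynardCube, ENNReal.one_rpow, one_mul,
              ENNReal.ofReal_toReal (ENNReal.div_ne_top hεt two_ne_zero)]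
    _ = ε := ENNReal.add_halves ε


/-! ### `I_k` and `J_k^{(m)}` as squared `L²` norms -/

/-- `∫ φ² = ‖φ‖²` (as a real number) for `φ ∈ L²`. [folklore] -/
theorem integral_sq_eq_toReal_sq {α : Type*} [MeasurableSpace α] {μ : Measure α} {φ : α → ℝ}
    (hφ : AEStronglyMeasurable φ μ) (hfin : eLpNorm φ 2 μ < ⊤) :
    ∫ x, φ x ^ 2 ∂μ = ((eLpNorm φ 2 μ).toReal) ^ 2 := by
  have hmem : MemLp φ 2 μ := ⟨hφ, hfin⟩
  rw [integral_sq_eq_toReal ((memLp_two_iff_integrable_sq hφ).1 hmem), ENNReal.toReal_pow]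

/-- For `φ` supported in `R_k ⊆ [0,1]^k`: `I_k(φ) = ∫_{[0,1]^k} φ²`. [folklore] -/
theorem maynardI_eq_setIntegral_cube {k : ℕ} {φ : (Fin k → ℝ) → ℝ}
    (hsupp : Function.support φ ⊆ maynardSimplex k) :
    maynardI k φ = ∫ t in maynardCube k, φ t ^ 2 := by
  rw [maynardI]
  refine (setIntegral_eq_of_subset_of_forall_sdiff_eq_zero (MaynardLargeK.measurableSet_maynardCube k)
    (maynardSimplex_subset_maynardCube k) fun t ht => ?_).symm
  have : φ t = 0 := by
    by_contra h
    exact ht.2 (hsupp h)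
  rw [this]; ring

/-- `I_k(φ) = ‖φ‖²_{L²([0,1]^k)}` for measurable `φ ∈ L²` supported in `R_k`. [folklore] -/
theorem maynardI_eq_toReal_sq {k : ℕ} {φ : (Fin k → ℝ) → ℝ} (hφ : Measurable φ)
    (hsupp : Function.support φ ⊆ maynardSimplex k)
    (hfin : eLpNorm φ 2 (volume.restrict (maynardCube k)) < ⊤) :
    maynardI k φ = ((eLpNorm φ 2 (volume.restrict (maynardCube k))).toReal) ^ 2 := by
  rw [maynardI_eq_setIntegral_cube hsupp, integral_sq_eq_toReal_sq hφ.aestronglyMeasurable hfin]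

/-- `J_k^{(m)}(φ) = ‖A_m φ‖²_{L²([0,1]^{k−1})}` for measurable `φ ∈ L²([0,1]^k)` supported in `R_k`.
[folklore] -/
theorem maynardJ_eq_toReal_sq (m : Fin (n + 1)) {φ : (Fin (n + 1) → ℝ) → ℝ} (hφ : Measurable φ)
    (hsupp : Function.support φ ⊆ maynardSimplex (n + 1))
    (hfin : eLpNorm φ 2 (volume.restrict (maynardCube (n + 1))) < ⊤) :
    maynardJ (n + 1) m φ =
      ((eLpNorm (fibreAvg m φ) 2 (volume.restrict (maynardCube n))).toReal) ^ 2 := by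
  rw [maynardJ_eq_integral_fibreAvg, Set.indicator_eq_self.2 hsupp]
  exact integral_sq_eq_toReal_sq (stronglyMeasurable_fibreAvg m hφ).aestronglyMeasurable
    ((eLpNorm_fibreAvg_le m hφ).trans_lt hfin)

/-- The fibres of a cut-off continuous function are interval integrable. [folklore] -/
theorem intervalIntegrable_fibre_indicator (m : Fin (n + 1)) {P : (Fin (n + 1) → ℝ) → ℝ}
    (hP : Continuous P) (s : Fin n → ℝ) :
    IntervalIntegrable (fun u => (maynardSimplex (n + 1)).indicator P (Fin.insertNth m u s)) volume 0 1 := by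
  have hins : Continuous fun u : ℝ => (Fin.insertNth (α := fun _ => ℝ) m u s : Fin (n + 1) → ℝ) := by
    fun_prop
  have hcont : Continuous fun u : ℝ => P (Fin.insertNth m u s) := hP.comp hins
  have h1 : IntervalIntegrable (fun u => P (Fin.insertNth m u s)) volume 0 1 :=
    hcont.intervalIntegrable 0 1
  rw [intervalIntegrable_iff_integrableOn_Ioc_of_le zero_le_one] at h1 ⊢
  have hset : MeasurableSet ((fun u : ℝ => (Fin.insertNth (α := fun _ => ℝ) m u s : Fin (n + 1) → ℝ)) ⁻¹'
      maynardSimplex (n + 1)) :=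
    (measurableSet_maynardSimplex _).preimage hins.measurable
  have := h1.indicator hset
  refine this.congr_fun (fun u _ => ?_) measurableSet_Ioc
  simp only [Set.indicator, Set.mem_preimage]
  rfl


/-! ### The approximation theorem -/

/-- The elementary inequality behind the `J`-estimate: if `0 ≤ b`, `a − δ ≤ b` then
`a² − 2aδ ≤ b²` (for `0 ≤ δ`, `0 ≤ a`). [folklore] -/
theorem sq_sub_le_sq {a b δ : ℝ} (ha : 0 ≤ a) (hb : 0 ≤ b) (hδ : 0 ≤ δ) (h : a - δ ≤ b) :
    a ^ 2 - 2 * a * δ ≤ b ^ 2 := by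
  rcases le_or_gt a δ with had | had
  · nlinarith
  · nlinarith

/-- **`C¹` test functions approximate square-integrable ones in the Maynard functional.** For an
admissible `F` on `R_k` (`k = n + 1`) and `0 ≤ c < (∑ₘ J_k^{(m)}(F))/I_k(F)` there is a polynomial
(hence `C¹`) function `G` with `1_{R_k} G` admissible and `(∑ₘ J_k^{(m)}(1_{R_k}G))/I_k(1_{R_k}G) > c`
(the standard remark that the supremum `M_k` over Maynard's piecewise-differentiable class and over
the square-integrable class of Polymath 8b §3 coincide; proof: `F ↦ √I_k(F)` and `F ↦ √J_k^{(m)}(F)`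
are `L²`-Lipschitz seminorms and polynomials are dense in `L²([0,1]^k)`).
[cite: Polymath8b2014, §3 (the L² class of test functions)] -/
theorem exists_polynomial_maynardFunctional_gt {F : (Fin (n + 1) → ℝ) → ℝ}
    (hF : IsMaynardAdmissible (n + 1) F) {c : ℝ} (hc0 : 0 ≤ c)
    (hc : c < maynardFunctional (n + 1) F) :
    ∃ q : MvPolynomial (Fin (n + 1)) ℝ,
      IsMaynardAdmissible (n + 1) ((maynardSimplex (n + 1)).indicator fun x => MvPolynomial.eval x q) ∧
        c < maynardFunctional (n + 1) ((maynardSimplex (n + 1)).indicator fun x => MvPolynomial.eval x q) := by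
  have hFm := hF.measurable
  have hFsupp : Function.support F ⊆ maynardSimplex (n + 1) := hF.support_subset
  have hFsuppC : Function.support F ⊆ maynardCube (n + 1) :=
    hFsupp.trans (maynardSimplex_subset_maynardCube _)
  have hFind : (maynardSimplex (n + 1)).indicator F = F := Set.indicator_eq_self.2 hFsupp
  -- `F ∈ L²(cube)`
  have hF2cube : IntegrableOn (fun t => F t ^ 2) (maynardCube (n + 1)) := by
    have h := hF.integrableOn_sq
    have : (fun t => F t ^ 2) = (maynardSimplex (n + 1)).indicator (fun t => F t ^ 2) := by
      funext t
      by_cases ht : t ∈ maynardSimplex (n + 1)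
      · rw [Set.indicator_of_mem ht]
      · rw [Set.indicator_of_notMem ht]
        have : F t = 0 := by rw [← hFind, Set.indicator_of_notMem ht]
        rw [this]; ring
    rw [this]
    exact ((integrable_indicator_iff (measurableSet_maynardSimplex _)).2 h).integrableOn
  have hFfin : eLpNorm F 2 (volume.restrict (maynardCube (n + 1))) < ⊤ :=
    ((memLp_two_iff_integrable_sq hFm.aestronglyMeasurable).2 hF2cube).eLpNorm_lt_top
  -- the real numbers `f = ‖F‖ = √I(F)`, `a m = ‖A_m F‖ = √J_m(F)`
  obtain ⟨f, hf⟩ : ∃ f : ℝ, f = (eLpNorm F 2 (volume.restrict (maynardCube (n + 1)))).toReal := ⟨_, rfl⟩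
  have hIf : maynardI (n + 1) F = f ^ 2 := by rw [hf]; exact maynardI_eq_toReal_sq hFm hFsupp hFfin
  have hf0 : 0 ≤ f := by rw [hf]; exact ENNReal.toReal_nonneg
  have hfpos : 0 < f := by
    have h := hF.maynardI_pos
    rw [hIf] at h
    rcases hf0.lt_or_eq with h' | h'
    · exact h'
    · rw [← h'] at h; norm_num at h
  obtain ⟨a, ha⟩ : ∃ a : Fin (n + 1) → ℝ,
      a = fun m => (eLpNorm (fibreAvg m F) 2 (volume.restrict (maynardCube n))).toReal := ⟨_, rfl⟩
  have hJa : ∀ m, maynardJ (n + 1) m F = a m ^ 2 := fun m => by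
    rw [ha]; exact maynardJ_eq_toReal_sq m hFm hFsupp hFfin
  have ha0 : ∀ m, 0 ≤ a m := fun m => by rw [ha]; exact ENNReal.toReal_nonneg
  obtain ⟨S, hS⟩ : ∃ S : ℝ, S = ∑ m, maynardJ (n + 1) m F := ⟨_, rfl⟩
  have hSa : S = ∑ m, a m ^ 2 := by rw [hS]; exact Finset.sum_congr rfl fun m _ => hJa m
  -- the room `gap = S − c f² > 0`
  have hMdef : maynardFunctional (n + 1) F = S / f ^ 2 := by rw [maynardFunctional, hIf, hS]
  have hgap : 0 < S - c * f ^ 2 := by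
    rw [hMdef, lt_div_iff₀ (by positivity)] at hc
    linarith
  -- choose `ε`
  have hsa : 0 ≤ ∑ m, a m := Finset.sum_nonneg fun m _ => ha0 m
  obtain ⟨K, hK⟩ : ∃ K : ℝ, K = 2 * ∑ m, a m + c * (2 * f + 1) := ⟨_, rfl⟩
  have hK0 : 0 ≤ K := by
    have : 0 ≤ c * (2 * f + 1) := by positivity
    linarith
  obtain ⟨εr, hεr⟩ : ∃ εr : ℝ, εr = min (1 / 2) (min (f / 2) ((S - c * f ^ 2) / (2 * (K + 1)))) :=
    ⟨_, rfl⟩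
  have hεr0 : 0 < εr := by
    rw [hεr, lt_min_iff, lt_min_iff]
    exact ⟨by norm_num, by positivity, by positivity⟩
  have hεr1 : εr ≤ 1 / 2 := by rw [hεr]; exact min_le_left _ _
  have hεrf : εr ≤ f / 2 := by rw [hεr]; exact (min_le_right _ _).trans (min_le_left _ _)
  have hεrg : εr ≤ (S - c * f ^ 2) / (2 * (K + 1)) := by
    rw [hεr]; exact (min_le_right _ _).trans (min_le_right _ _)
  obtain ⟨q, hq⟩ := exists_mvPolynomial_eLpNorm_sub_le hFm hFsuppC hF2cube
    (ε := ENNReal.ofReal εr) (by simpa using hεr0)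
  obtain ⟨P, hP⟩ : ∃ P : (Fin (n + 1) → ℝ) → ℝ, P = fun x => MvPolynomial.eval x q := ⟨_, rfl⟩
  have hPc : Continuous P := by rw [hP]; exact (contDiff_mvPolynomial_eval q).continuous
  obtain ⟨Q, hQ⟩ : ∃ Q : (Fin (n + 1) → ℝ) → ℝ, Q = (maynardSimplex (n + 1)).indicator P := ⟨_, rfl⟩
  have hQm : Measurable Q := by rw [hQ]; exact hPc.measurable.indicator (measurableSet_maynardSimplex _)
  have hQsupp : Function.support Q ⊆ maynardSimplex (n + 1) := by
    rw [hQ]; exact Set.support_indicator_subset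
  -- `d = ‖F − Q‖ ≤ εr`
  have hFQ : F - Q = (maynardSimplex (n + 1)).indicator (F - P) := by
    funext t
    by_cases ht : t ∈ maynardSimplex (n + 1)
    · simp [hQ, Set.indicator_of_mem ht]
    · have hFt : F t = 0 := by rw [← hFind, Set.indicator_of_notMem ht]
      simp [hQ, Set.indicator_of_notMem ht, hFt]
  have hd : eLpNorm (F - Q) 2 (volume.restrict (maynardCube (n + 1))) ≤ ENNReal.ofReal εr := by
    rw [hFQ]
    refine (eLpNorm_indicator_le _).trans ?_
    rw [hP]
    exact hq
  have hdfin : eLpNorm (F - Q) 2 (volume.restrict (maynardCube (n + 1))) < ⊤ :=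
    hd.trans_lt ENNReal.ofReal_lt_top
  obtain ⟨δ, hδ⟩ : ∃ δ : ℝ, δ = (eLpNorm (F - Q) 2 (volume.restrict (maynardCube (n + 1)))).toReal :=
    ⟨_, rfl⟩
  have hδ0 : 0 ≤ δ := by rw [hδ]; exact ENNReal.toReal_nonneg
  have hδε : δ ≤ εr := by
    have := ENNReal.toReal_mono ENNReal.ofReal_ne_top hd
    rwa [ENNReal.toReal_ofReal hεr0.le, ← hδ] at this
  -- `g = ‖Q‖`, with `g ≤ f + δ` and `f ≤ g + δ`
  have hFa := hFm.aestronglyMeasurable (μ := volume.restrict (maynardCube (n + 1)))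
  have hQa := hQm.aestronglyMeasurable (μ := volume.restrict (maynardCube (n + 1)))
  have hQfin : eLpNorm Q 2 (volume.restrict (maynardCube (n + 1))) < ⊤ := by
    have : Q = F - (F - Q) := by simp
    rw [this]
    exact (eLpNorm_sub_le hFa (hFa.sub hQa) (by norm_num)).trans_lt
      (ENNReal.add_lt_top.2 ⟨hFfin, hdfin⟩)
  obtain ⟨g, hg⟩ : ∃ g : ℝ, g = (eLpNorm Q 2 (volume.restrict (maynardCube (n + 1)))).toReal := ⟨_, rfl⟩
  have hIg : maynardI (n + 1) Q = g ^ 2 := by rw [hg]; exact maynardI_eq_toReal_sq hQm hQsupp hQfin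
  have hgf : g ≤ f + δ := by
    have h1 : eLpNorm Q 2 (volume.restrict (maynardCube (n + 1))) ≤
        eLpNorm F 2 (volume.restrict (maynardCube (n + 1))) +
          eLpNorm (F - Q) 2 (volume.restrict (maynardCube (n + 1))) := by
      have : Q = F + (Q - F) := by simp
      calc eLpNorm Q 2 (volume.restrict (maynardCube (n + 1)))
          = eLpNorm (F + (Q - F)) 2 (volume.restrict (maynardCube (n + 1))) := by rw [← this]
        _ ≤ eLpNorm F 2 (volume.restrict (maynardCube (n + 1))) +
              eLpNorm (Q - F) 2 (volume.restrict (maynardCube (n + 1))) :=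
            eLpNorm_add_le hFa (hQa.sub hFa) (by norm_num)
        _ = _ := by rw [eLpNorm_sub_comm]
    have := ENNReal.toReal_mono (ENNReal.add_ne_top.2 ⟨hFfin.ne, hdfin.ne⟩) h1
    rwa [ENNReal.toReal_add hFfin.ne hdfin.ne, ← hg, ← hf, ← hδ] at this
  have hfg : f ≤ g + δ := by
    have h1 : eLpNorm F 2 (volume.restrict (maynardCube (n + 1))) ≤
        eLpNorm Q 2 (volume.restrict (maynardCube (n + 1))) +
          eLpNorm (F - Q) 2 (volume.restrict (maynardCube (n + 1))) := by
      have : F = Q + (F - Q) := by simp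
      calc eLpNorm F 2 (volume.restrict (maynardCube (n + 1)))
          = eLpNorm (Q + (F - Q)) 2 (volume.restrict (maynardCube (n + 1))) := by rw [← this]
        _ ≤ _ := eLpNorm_add_le hQa (hFa.sub hQa) (by norm_num)
    have := ENNReal.toReal_mono (ENNReal.add_ne_top.2 ⟨hQfin.ne, hdfin.ne⟩) h1
    rwa [ENNReal.toReal_add hQfin.ne hdfin.ne, ← hg, ← hf, ← hδ] at this
  have hgpos : 0 < g := by linarith
  -- `b m = ‖A_m Q‖ ≥ a m − δ`
  obtain ⟨b, hb⟩ : ∃ b : Fin (n + 1) → ℝ,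
      b = fun m => (eLpNorm (fibreAvg m Q) 2 (volume.restrict (maynardCube n))).toReal := ⟨_, rfl⟩
  have hJb : ∀ m, maynardJ (n + 1) m Q = b m ^ 2 := fun m => by
    rw [hb]; exact maynardJ_eq_toReal_sq m hQm hQsupp hQfin
  have hb0 : ∀ m, 0 ≤ b m := fun m => by rw [hb]; exact ENNReal.toReal_nonneg
  have hab : ∀ m, a m - δ ≤ b m := by
    intro m
    have h1 := eLpNorm_fibreAvg_le_add m (F := F) (Q := Q) hFm hQm
      (fun s => by rw [hQ]; exact intervalIntegrable_fibre_indicator m hPc s)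
    have hAQfin : eLpNorm (fibreAvg m Q) 2 (volume.restrict (maynardCube n)) < ⊤ :=
      (eLpNorm_fibreAvg_le m hQm).trans_lt hQfin
    have := ENNReal.toReal_mono (ENNReal.add_ne_top.2 ⟨hAQfin.ne, hdfin.ne⟩) h1
    rw [ENNReal.toReal_add hAQfin.ne hdfin.ne, ← hδ] at this
    have e1 : a m = (eLpNorm (fibreAvg m F) 2 (volume.restrict (maynardCube n))).toReal := by rw [ha]
    have e2 : b m = (eLpNorm (fibreAvg m Q) 2 (volume.restrict (maynardCube n))).toReal := by rw [hb]
    rw [e1, e2]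
    linarith
  -- admissibility of `Q`
  have hIQpos : 0 < ∫ t in maynardSimplex (n + 1), P t ^ 2 := by
    rw [← MaynardTao.maynardI_indicator_eq, ← hQ, hIg]; positivity
  have hQadm : IsMaynardAdmissible (n + 1) Q := by
    rw [hQ]; exact MaynardTao.isMaynardAdmissible_indicator hPc hIQpos
  have hQeq : ((maynardSimplex (n + 1)).indicator fun x => MvPolynomial.eval x q) = Q := by rw [hQ, hP]
  refine ⟨q, hQeq ▸ hQadm, ?_⟩
  -- the inequality `c < Σ b² / g²`
  rw [hQeq, maynardFunctional, hIg, lt_div_iff₀ (by positivity)]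
  have hsum : ∑ m, maynardJ (n + 1) m Q = ∑ m, b m ^ 2 := Finset.sum_congr rfl fun m _ => hJb m
  rw [hsum]
  have h1 : ∑ m, (a m ^ 2 - 2 * a m * δ) ≤ ∑ m, b m ^ 2 :=
    Finset.sum_le_sum fun m _ => sq_sub_le_sq (ha0 m) (hb0 m) hδ0 (hab m)
  have h2 : ∑ m, (a m ^ 2 - 2 * a m * δ) = S - 2 * δ * ∑ m, a m := by
    rw [Finset.sum_sub_distrib, ← hSa, Finset.mul_sum]
    congr 1
    exact Finset.sum_congr rfl fun m _ => by ring
  have h3 : c * g ^ 2 ≤ c * (f + δ) ^ 2 := by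
    refine mul_le_mul_of_nonneg_left ?_ hc0
    exact pow_le_pow_left₀ hgpos.le hgf 2
  have hδ1 : δ ≤ 1 := by linarith
  have h4 : c * (f + δ) ^ 2 ≤ c * f ^ 2 + δ * (c * (2 * f + 1)) := by
    have : c * (f + δ) ^ 2 = c * f ^ 2 + δ * (c * (2 * f + δ)) := by ring
    rw [this]
    gcongr
  have h5 : δ * K < S - c * f ^ 2 := by
    calc δ * K ≤ εr * K := mul_le_mul_of_nonneg_right hδε hK0
      _ ≤ (S - c * f ^ 2) / (2 * (K + 1)) * K := mul_le_mul_of_nonneg_right hεrg hK0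
      _ < S - c * f ^ 2 := by
          rw [div_mul_eq_mul_div, div_lt_iff₀ (by positivity)]
          nlinarith
  calc c * g ^ 2 ≤ c * f ^ 2 + δ * (c * (2 * f + 1)) := h3.trans h4
    _ < S - 2 * δ * ∑ m, a m := by
        have : δ * K = 2 * δ * ∑ m, a m + δ * (c * (2 * f + 1)) := by rw [hK]; ring
        linarith
    _ = ∑ m, (a m ^ 2 - 2 * a m * δ) := h2.symm
    _ ≤ ∑ m, b m ^ 2 := h1


end MaynardL2

/-! ### The reduction -/

/-- For `k = 0` the Maynard functional vanishes (empty sum of `J`'s). [folklore] -/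
theorem maynardFunctional_zero (F : (Fin 0 → ℝ) → ℝ) : maynardFunctional 0 F = 0 := by
  simp [maynardFunctional]

/-- **The `L²` reduction of Maynard's Prop. 4.2.** The `C¹` case of Prop. 4.2
(`frequently_card_primes_ge_of_maynardFunctional_smooth`, `MaynardSieve.lean`: test functions
`F = G · 1_{R_k}`, `G ∈ C¹` — the class Prop. 4.1 is printed for) implies the general case
(`frequently_card_primes_ge_of_maynardFunctional`, `MaynardTao.lean`: every square-integrable
admissible `F`, the generality of Polymath 8b §3): given `F` with `(∑ₘ J^{(m)}(F))/I(F) > 2m/θ`,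
`MaynardL2.exists_polynomial_maynardFunctional_gt` supplies a polynomial `G` with the same strict
inequality, to which the `C¹` case applies. [cite: Polymath8b2014, §3 (the L² class of test functions)] -/
theorem frequently_card_primes_ge_of_maynardFunctional_of_smooth
    (h : frequently_card_primes_ge_of_maynardFunctional_smooth) :
    frequently_card_primes_ge_of_maynardFunctional := by
  intro θ hθ0 hθ m k F hF hM H hH hk
  cases k with
  | zero =>
    exfalso
    rw [maynardFunctional_zero] at hM
    have : (0 : ℝ) ≤ 2 * (m : ℝ) / θ := by positivity
    linarith
  | succ n =>
    obtain ⟨q, hadm, hgt⟩ :=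
      MaynardL2.exists_polynomial_maynardFunctional_gt hF (c := 2 * (m : ℝ) / θ) (by positivity) hM
    exact h θ hθ0 hθ m (n + 1) (fun x => MvPolynomial.eval x q)
      ((MaynardL2.contDiff_mvPolynomial_eval q).of_le le_top) hadm hgt H hH hk

/-- **Maynard's Prop. 4.2 (general, square-integrable form) from the two Prop. 4.1 facts.**
`maynard_S1_asymptotic` and `maynard_S2_asymptotic` (`MaynardSieve.lean`) imply
`frequently_card_primes_ge_of_maynardFunctional` (via the tree's deduction of the `C¹` case,
`frequently_card_primes_ge_of_maynardFunctional_smooth_of_asymptotics`, and the `L²` reduction).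
[cite: MaynardAnnals2015, Prop. 4.2] -/
theorem frequently_card_primes_ge_of_maynardFunctional_of_asymptotics
    (hS1 : maynard_S1_asymptotic) (hS2 : maynard_S2_asymptotic) :
    frequently_card_primes_ge_of_maynardFunctional :=
  frequently_card_primes_ge_of_maynardFunctional_of_smooth
    (frequently_card_primes_ge_of_maynardFunctional_smooth_of_asymptotics hS1 hS2)

/-! ### Consequence for Maynard's Theorem 1.1 (parity.S13) -/

/-- **Maynard 2015, Theorem 1.1 (`liminf (p_{n+m} − p_n) ≪ m³e^{4m}`) from Bombieri–Vinogradov and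
the two Prop. 4.1 facts.** With Prop. 4.3 (3) discharged (`exists_maynardFunctional_gt_holds`,
`MaynardTaoLargeKProofs.lean`) and Prop. 4.2 reduced to `maynard_S1_asymptotic`,
`maynard_S2_asymptotic` (above), the assembly
`Parity.frequently_nth_prime_add_le_maynard_tao_of_bombieri_vinogradov`
(`ParityWave0MaynardTaoProofs.lean`) leaves exactly these three named facts as hypotheses.
[cite: MaynardAnnals2015, Theorem 1.1 and §4 (proof of Theorem 1.1)] -/
theorem frequently_nth_prime_add_le_maynard_tao_of_sieve_asymptotics
    (hBV : Sieve.bombieri_vinogradov) (hS1 : maynard_S1_asymptotic) (hS2 : maynard_S2_asymptotic) :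
    Sieve.frequently_nth_prime_add_le_maynard_tao :=
  Sieve.frequently_nth_prime_add_le_maynard_tao_of_bombieri_vinogradov hBV
    exists_maynardFunctional_gt_holds
    (frequently_card_primes_ge_of_maynardFunctional_of_asymptotics hS1 hS2)

end Literature.NumberTheory.Sieve
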